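import Mathlib.Analysis.SpecialFunctions.Pow.Real
import HarnessLib

/-!
# `NoHeavyLowerTail` (stmt-CriticalPhenomena-4575) — real-variable core of the PARALLEL-COMPOSITION CONSTANT `28/27` for `E = κ²/(pπ·m)`

Support file (prover prim-ineq-gen-8 gen 58; `--supports stmt-CriticalPhenomena-4575`; memo
run/shared/lean/prim/prim-ineq-gen-8/FINDING-gen58-SERIES-LEAN.md §0(3),(4)).  No definitions, no named facts, no sorries.

Setting of the memo (the weak-apex face of the parallel-composition problem).  A three-point configuration `(o; u, v)` whose apex is attached
with intensity `ε → 0` is described to first order by the rates `a = P(o↔u)/ε`, `b = P(o↔v)/ε`, `t = P(o↔u↔v)/ε` (`t ≤ a, b`) and `s = P(u↔v)`;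
then `E → t²/(a·b·s)`.  Composing it in PARALLEL with an apex-free `u–v` connection of probability `w` ("shortcut") gives the rates
`t′ = t + w(a + b − 2t)`, `a′ = a + w(b − t)`, `b′ = b + w(a − t)`, `s′ = s + w(1 − s)`.  Normalise `a = 1`, `b = β ≥ t`, and take the
extremal `s = t²/(Cβ)` (`E = C` exactly).  Then (`shortcut_defect_eq`) the defect `β·(C·a′b′s′ − t′²)` (times `C`) is `w · K(w)` with
`K(0) = K₀(β,t) = β²(C − 2t + t²) − βt(1−t)(2−t) + t²(1−t)`, and (`shortcut_first_order`, `shortcut_first_order_sharp`)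
**`K₀ ≥ 0` for all `β` and `t ∈ [0,1]` when `C = 28/27`, while `K₀(1, 2/3) = C − 28/27`**: an infinitesimal apex-free shortcut can push `E`
above `C` iff `C < 28/27` — the first-order origin of the conjectured parallel-composition constant `28/27` of the `E`-route (memo §0(3): with the
series reduction theorem `series_reduction`, closure of `{E ≤ 28/27}` under parallel composition would give `E ≤ 28/27` on every apex-over-series-
parallel graph).  Also `K₂ = (1−t)(β−t)(Cβ−t²) ≥ 0` (`shortcut_K2_nonneg`), so the full weak-face inequality `K(w) = K₀ + K₁w + K₂w² ≥ 0` on `w ∈ [0,1]`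
reduces to `4K₀K₂ ≥ K₁²` where `K₁ < 0` — open (memo §0(3)(c): numerically true, min `→ 0` at the tangency `(β,t) = (1,2/3)`). [this work]
-/

namespace Summit.CriticalPhenomena.PercolationContinuityZ3.Theorems

namespace APL

/-- **The weak-face shortcut defect factorises through `w`.**  With `a = 1`, `b = β`, extremal `s = t²/(Cβ)` (written multiplied out by `Cβ`):
`Cβ·[C·a′b′s′ − t′²] = w·(K₀ + K₁w + K₂w²)·C` as a polynomial identity in `(C, β, t, w)`, where the shortcut rates are
`t′ = t + w(1 + β − 2t)`, `a′ = 1 + w(β − t)`, `b′ = β + w(1 − t)`, `Cβ·s′ = t² + w(Cβ − t²)`. [this work] -/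
theorem shortcut_defect_eq (C β t w : ℝ) :
    (1 + w * (β - t)) * (β + w * (1 - t)) * (t ^ 2 + w * (C * β - t ^ 2)) - β * (t + w * (1 + β - 2 * t)) ^ 2
      = w * ((β ^ 2 * (C - 2 * t + t ^ 2) - β * t * (1 - t) * (2 - t) + t ^ 2 * (1 - t))
          + w * ((C - 1) * (β + β ^ 3) + (4 - C) * β * t * (1 + β) - 2 * β ^ 2 - t ^ 2 + t ^ 4 - 3 * β * t ^ 2 - β ^ 2 * t ^ 2)
          + w ^ 2 * ((1 - t) * (β - t) * (C * β - t ^ 2))) := by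
  ring

/-- The `w²`-coefficient `K₂ = (1−t)(β−t)(Cβ − t²)` of the defect is nonnegative on the admissible region (`t ≤ 1`, `t ≤ β`, and
`t² ≤ Cβ`, i.e. `s = t²/(Cβ) ≤ 1`). [this work] -/
theorem shortcut_K2_nonneg (C β t : ℝ) (ht1 : t ≤ 1) (htβ : t ≤ β) (hs : t ^ 2 ≤ C * β) :
    0 ≤ (1 - t) * (β - t) * (C * β - t ^ 2) :=
  mul_nonneg (mul_nonneg (sub_nonneg.2 ht1) (sub_nonneg.2 htβ)) (sub_nonneg.2 hs)

/-- **First-order threshold `28/27`.**  `K₀(β,t) = β²(28/27 − 2t + t²) − βt(1−t)(2−t) + t²(1−t) ≥ 0` for all real `β` and `0 ≤ t ≤ 1`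
(a quadratic in `β` with leading coefficient `(1−t)² + 1/27 > 0` and discriminant `−t²(1−t)(t − 2/3)²(t + 1/3) ≤ 0`). [this work] -/
theorem shortcut_first_order (β t : ℝ) (ht0 : 0 ≤ t) (ht1 : t ≤ 1) :
    0 ≤ β ^ 2 * (28 / 27 - 2 * t + t ^ 2) - β * t * (1 - t) * (2 - t) + t ^ 2 * (1 - t) := by
  nlinarith [sq_nonneg (β * (28/27 - 2*t + t^2) - t * (1 - t) * (2 - t) / 2), sq_nonneg (t - 2/3), mul_nonneg ht0 (sub_nonneg.2 ht1),
    mul_nonneg (mul_nonneg (sq_nonneg t) (sub_nonneg.2 ht1)) (mul_nonneg (sq_nonneg (t - 2/3)) (by linarith : (0:ℝ) ≤ t + 1/3)),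
    sq_nonneg (1 - t)]

/-- **Sharpness of `28/27`**: at the symmetric piece `β = 1`, `t = 2/3` (i.e. `P(o↔u↔v) = (2/3)·P(o↔u)` to first order and `P(u↔v) = 3/7`)
the first-order defect equals `C − 28/27`, negative for every `C < 28/27`. [this work] -/
theorem shortcut_first_order_sharp (C : ℝ) :
    (1 : ℝ) ^ 2 * (C - 2 * (2 / 3) + (2 / 3) ^ 2) - 1 * (2 / 3) * (1 - 2 / 3) * (2 - 2 / 3) + (2 / 3) ^ 2 * (1 - 2 / 3) = C - 28 / 27 := by
  ring

/-! ### Appended (gen 58, second landing): the Cauchy–Schwarz reduction and the certified weak-face lemma (documentation) -/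

/-- `4x² ≤ s²`, `s ≥ 0` ⟹ `2x ≤ s`. [folklore] -/
private theorem two_mul_le_of_sq_par {x s : ℝ} (hs : 0 ≤ s) (h : 4 * x ^ 2 ≤ s ^ 2) : 2 * x ≤ s := by
  nlinarith [sq_nonneg (s - 2 * x), sq_nonneg (s + 2 * x), hs]

/-- **Cauchy–Schwarz reduction of a general weak-face parallel composition to two shortcuts** (memo §0(3)(b)).  On the weak-apex face the
union of two pieces has rates `t = T₁ + T₂`, `a = α₁ + α₂`, `b = β₁ + β₂` and common `s`, where `(Tᵢ, αᵢ, βᵢ, s)` are exactly the data of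
piece `i` shortcut by the apex-free connection probability of the other piece; so if each shortcut satisfies `Tᵢ² ≤ C·αᵢβᵢ·s`, then
`(T₁ + T₂)² ≤ C·(α₁ + α₂)(β₁ + β₂)·s`, i.e. the union satisfies `E ≤ C`.  Together with the weak-face shortcut lemma at `C = 28/27`
(`K ≥ 0`; certified by exact rational S-procedure SOS certificates on nine boxes plus elementary bounds, memo §0(3)(c) and
HOME/code-g58/certs/ — not yet replayed in Lean) this gives: on the weak-apex face, parallel composition preserves `E ≤ 28/27`, sharp. [this work] -/
theorem union_cs_core (C s T₁ T₂ α₁ β₁ α₂ β₂ : ℝ) (hC : 0 ≤ C) (hs : 0 ≤ s)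
    (hα₁ : 0 ≤ α₁) (hβ₁ : 0 ≤ β₁) (hα₂ : 0 ≤ α₂) (hβ₂ : 0 ≤ β₂)
    (h₁ : T₁ ^ 2 ≤ C * α₁ * β₁ * s) (h₂ : T₂ ^ 2 ≤ C * α₂ * β₂ * s) :
    (T₁ + T₂) ^ 2 ≤ C * (α₁ + α₂) * (β₁ + β₂) * s := by
  have cross : 2 * (T₁ * T₂) ≤ C * s * (α₁ * β₂ + α₂ * β₁) := by
    apply two_mul_le_of_sq_par
    · nlinarith [mul_nonneg (mul_nonneg hC hs) (add_nonneg (mul_nonneg hα₁ hβ₂) (mul_nonneg hα₂ hβ₁))]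
    · have h3 : (T₁ * T₂) ^ 2 ≤ (C * α₁ * β₁ * s) * (C * α₂ * β₂ * s) := by
        rw [mul_pow]; exact mul_le_mul h₁ h₂ (sq_nonneg _) (le_trans (sq_nonneg _) h₁)
      have h4 : (C * α₁ * β₁ * s) * (C * α₂ * β₂ * s) = (C * s * (α₁ * β₂)) * (C * s * (α₂ * β₁)) := by ring
      have h5 : 4 * ((C * s * (α₁ * β₂)) * (C * s * (α₂ * β₁))) ≤ (C * s * (α₁ * β₂ + α₂ * β₁)) ^ 2 := by
        nlinarith [sq_nonneg (C * s * (α₁ * β₂) - C * s * (α₂ * β₁))]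
      nlinarith [h3, h4, h5]
  nlinarith [cross, h₁, h₂]

end APL

end Summit.CriticalPhenomena.PercolationContinuityZ3.Theorems
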